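import Mathlib

/-!
# SoloBlind — the two degenerate classes of the leaf-moment coefficient κ

Solo programme `solo-AnomalousDissipation-blind`, paper §24.4 / §24.10 (SEIL-F).
For a planar carrier `V₀ = ∇⊥ψ₀` the leaf-moment operator of the linearised steady
forced Euler operator `L φ = {ψ₀, Δφ} + {φ, ω₀}` has principal coefficient, on the leaf
`C_ψ` parametrised by transit time `t ∈ [0, T]`,

  `κ(ψ) = ∮ |∇ψ₀|⁻² (dω₀/dt) dt = ∫₀ᵀ w(t) g(t) dt`,  `w = |∇ψ₀|⁻² ∘ γ`, `g = (dω₀/dt) ∘ γ`.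

Two classes of carriers make `κ` vanish identically:
* (a) EULER carriers: `dω₀/dt ≡ 0` (vorticity constant on leaves), so `g = 0`;
* (b) REVERSIBLE carriers: an orientation-reversing isometry `R` with `ψ₀ ∘ R = ψ₀` maps
  each leaf to itself with `t ↦ T - t`; `|∇ψ₀|` and `ω₀` are `R`-even, `d/dt` is `R`-odd,
  so `w (T - t) = w t` and `g (T - t) = - g t`.

This file proves the abstract core (and, below, the planar linear algebra behind (b)): an interval integral over `[0, T]` of (even) × (odd)
under `t ↦ T - t` vanishes (no integrability hypothesis is needed: the change of variables
and `∫ -f = -∫ f` hold unconditionally for the interval integral), and the two corollaries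
named after the classes. On carriers outside both classes `κ ≠ 0` was measured
(work/seilf/meander.py: κ ∈ [-3.19, -0.18] on 32/32 leaves) and the linear persistence test
kit j178798 separates the three classes exactly (d/ν plateau vs. 0.779/ν vs. 1/ν).
The modelling step (that `κ` is the principal symbol of the leaf row) is not formalised.
-/

namespace Summit.AnomalousDissipation.AnomalousDissipation.Theorems

open MeasureTheory intervalIntegral Matrix

/-- Even × odd under the reflection `t ↦ T - t` integrates to zero over `[0, T]`. -/
theorem intervalIntegral_mul_eq_zero_of_even_odd (T : ℝ) (w g : ℝ → ℝ)
    (hw : ∀ t, w (T - t) = w t) (hg : ∀ t, g (T - t) = -g t) :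
    ∫ t in (0 : ℝ)..T, w t * g t = 0 := by
  have h1 : ∫ t in (0 : ℝ)..T, w (T - t) * g (T - t) = ∫ t in (T - T)..(T - 0), w t * g t :=
    intervalIntegral.integral_comp_sub_left (fun t => w t * g t) T
  simp only [sub_self, sub_zero] at h1
  have h2 : ∫ t in (0 : ℝ)..T, w (T - t) * g (T - t) = -∫ t in (0 : ℝ)..T, w t * g t := by
    have : (fun t => w (T - t) * g (T - t)) = fun t => -(w t * g t) := by
      funext t; rw [hw t, hg t]; ring
    rw [this, intervalIntegral.integral_neg]
  linarith

/-- Class (b): on a REVERSIBLE leaf (weight `R`-even, vorticity rate `R`-odd under the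
reversal `t ↦ T - t` of transit time) the leaf-moment coefficient `κ = ∫₀ᵀ w g` vanishes. -/
theorem leafMoment_eq_zero_of_reversible (T : ℝ) (w g : ℝ → ℝ)
    (hw : ∀ t, w (T - t) = w t) (hg : ∀ t, g (T - t) = -g t) :
    ∫ t in (0 : ℝ)..T, w t * g t = 0 :=
  intervalIntegral_mul_eq_zero_of_even_odd T w g hw hg

/-- Class (a): on an EULER leaf (vorticity constant along the leaf, `g = dω₀/dt ≡ 0` on
`[0, T]`) the leaf-moment coefficient vanishes. -/
theorem leafMoment_eq_zero_of_euler (T : ℝ) (w g : ℝ → ℝ)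
    (hg : ∀ t ∈ Set.uIcc (0 : ℝ) T, g t = 0) :
    ∫ t in (0 : ℝ)..T, w t * g t = 0 := by
  have : ∫ t in (0 : ℝ)..T, w t * g t = ∫ t in (0 : ℝ)..T, (0 : ℝ) := by
    apply intervalIntegral.integral_congr
    intro t ht
    simp [hg t ht]
  rw [this]; simp

/-- The same symmetry kills the FULL leaf moment on reversible data, not only its principal
symbol: for any `R`-even test function `φ` along the leaf (e.g. `Δ⁻¹(η ∘ ψ₀) ∘ γ`, even
because `R` is an isometry fixing `ψ₀`) the moment `∮ φ (dω₀/dt) dt` vanishes. Stated for a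
family of even weights at once. -/
theorem leafMoment_family_eq_zero_of_reversible (T : ℝ) (g : ℝ → ℝ)
    (hg : ∀ t, g (T - t) = -g t) (Φ : ℕ → ℝ → ℝ) (hΦ : ∀ n t, Φ n (T - t) = Φ n t) :
    ∀ n, ∫ t in (0 : ℝ)..T, Φ n t * g t = 0 :=
  fun n => intervalIntegral_mul_eq_zero_of_even_odd T (Φ n) g (hΦ n) hg

/-- Contrapositive used as the DESIGN RULE of §24.6: a leaf with `κ ≠ 0` is not reversible
(for the given weight/rate pair) — the carrier must break every leaf-preserving
orientation-reversing symmetry. -/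
theorem not_reversible_of_leafMoment_ne_zero (T : ℝ) (w g : ℝ → ℝ)
    (hw : ∀ t, w (T - t) = w t) (hκ : ∫ t in (0 : ℝ)..T, w t * g t ≠ 0) :
    ¬ (∀ t, g (T - t) = -g t) :=
  fun hg => hκ (intervalIntegral_mul_eq_zero_of_even_odd T w g hw hg)

/-! ## Why a reflection symmetry of `ψ₀` reverses transit time (planar linear algebra)
For `R ∈ O(2)` with `det R = −1` one has `R J = −J R` (`J` = rotation by π/2), hence for an
`R`-invariant stream function (`∇ψ₀ (R x) = R ∇ψ₀ x`, the chain rule) the velocity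
`V₀ = J ∇ψ₀` satisfies `V₀ (R x) = −R V₀ x`: `R` maps leaves to leaves reversing the flow
direction, so `d/dt` is `R`-odd while `ω₀ = Δψ₀` and `|∇ψ₀|` are `R`-even — the hypotheses
`hw`, `hg` above. (The chain-rule step is taken as the hypothesis `hgrad`.) -/

/-- rotation by π/2 (the planar symplectic matrix): `∇⊥ψ = Jrot *ᵥ ∇ψ`. -/
def Jrot : Matrix (Fin 2) (Fin 2) ℝ := !![0, -1; 1, 0]

/-- An orthogonal 2×2 matrix of determinant −1 is a reflection: `R₁₁ = −R₀₀`, `R₁₀ = R₀₁`. -/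
theorem reflection_entries (R : Matrix (Fin 2) (Fin 2) ℝ) (hO : Rᵀ * R = 1) (hdet : R.det = -1) :
    R 1 1 = -R 0 0 ∧ R 1 0 = R 0 1 := by
  -- R is invertible with inverse Rᵀ; also R⁻¹ = (det R)⁻¹ • adjugate R = -adjugate R
  have hinv : R⁻¹ = Rᵀ := Matrix.inv_eq_left_inv hO
  have hadj : R⁻¹ = -(R.adjugate) := by
    rw [Matrix.inv_def, hdet]; simp
  have hT : Rᵀ = -(R.adjugate) := by rw [← hinv, hadj]
  have e00 := congrFun (congrFun hT 0) 0
  have e10 := congrFun (congrFun hT 0) 1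
  simp [Matrix.adjugate_fin_two, Matrix.transpose_apply] at e00 e10
  constructor <;> linarith

/-- Orientation-reversing planar isometries ANTIcommute with the rotation by π/2. -/
theorem reflection_anticomm_Jrot (R : Matrix (Fin 2) (Fin 2) ℝ) (hO : Rᵀ * R = 1) (hdet : R.det = -1) :
    R * Jrot = -(Jrot * R) := by
  obtain ⟨h11, h10⟩ := reflection_entries R hO hdet
  have hR : R = !![R 0 0, R 0 1; R 0 1, -R 0 0] := by
    ext i j; fin_cases i <;> fin_cases j <;> simp [h11, h10]
  rw [hR]; simp only [Jrot, Matrix.mul_fin_two]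
  ext i j; fin_cases i <;> fin_cases j <;> simp

/-- Consequence (time reversal on leaves): if the gradient of the stream function is
`R`-equivariant, `∇ψ (R x) = R (∇ψ x)` (which is the chain rule for `ψ ∘ R = ψ` with `R`
orthogonal), then the velocity `V = Jrot ∇ψ` is ANTI-equivariant: `V (R x) = −R (V x)`.
So `R` maps each leaf to itself reversing the transit time, and every material derivative
`d/dt` along leaves is `R`-odd. -/
theorem velocity_antiequivariant (R : Matrix (Fin 2) (Fin 2) ℝ) (hO : Rᵀ * R = 1) (hdet : R.det = -1)
    (grad : (Fin 2 → ℝ) → (Fin 2 → ℝ)) (hgrad : ∀ x, grad (R *ᵥ x) = R *ᵥ grad x) (x : Fin 2 → ℝ) :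
    Jrot *ᵥ grad (R *ᵥ x) = -(R *ᵥ (Jrot *ᵥ grad x)) := by
  rw [hgrad x, Matrix.mulVec_mulVec, Matrix.mulVec_mulVec]
  have h := reflection_anticomm_Jrot R hO hdet
  -- Jrot * R = -(R * Jrot)
  have h' : Jrot * R = -(R * Jrot) := by rw [h]; simp
  rw [h', Matrix.neg_mulVec]


end Summit.AnomalousDissipation.AnomalousDissipation.Theorems
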